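import Literature.NumberTheory.GaloisRepresentations.IdeleSUnitsClassSequence
import Literature.NumberTheory.GaloisRepresentations.IdeleInflation
import HarnessLib

/-!
# Layer change (inflation) for the `S`-unit / `S`-idèle / idèle-class sequence in a tower `F ⊆ E ⊆ E'` of Galois
# extensions: `J_{E,S} → J_{E',S}`, `𝒪_{E,S}ˣ → 𝒪_{E',S}ˣ` over `res : Gal(E'/F) ↠ Gal(E/F)`, the commuting squares, and
# `Inf` on `Hⁿ` (Neukirch–Schmidt–Wingberg VIII §3 (8.3.9)–(8.3.11), Tate C–F VII §8, §11.1; Harari §17.4 (17.1))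

Topic `NumberTheory/GaloisRepresentations`; namespace `Literature.NumberTheory.GaloisRepresentations.IdeleCohomology`,
continuing `IdeleSUnitsClassSequence.lean` (one finite layer: `ideleSToClass S : J_{E,S} → C_E`, its kernel
`sUnitsIdeleRep F E S` = `𝒪_{E,S}ˣ` as the principal `S`-idèles with `sUnitsIdeleι S`, the kernel universal property
`sUnitsIdeleLift`) and the tree's `IdeleInflation.lean` (the pair morphisms `ideleInflHom F E E' : Res_{res}(J_E) ⟶ J_{E'}`,
`classInflHom F E E' : Res_{res}(C_E) ⟶ C_{E'}` over `res = AlgEquiv.restrictNormalHom E : Gal(E'/F) →* Gal(E/F)`, their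
square `res_classRepHom_comp_classInflHom`, and `Inf = groupCohomology.map res _ n`).  Definitions with bodies (two pair
morphisms, two families of `Inf` maps) and theorems; NO named fact, no `sorry`, no instance, no notation; number fields
in `Type`.

Mathematics.  In a tower `F ⊆ E ⊆ E'` of number fields with `E/F`, `E'/F` Galois and `S` a finite set of finite places of
`F`, the base change of idèles `x ↦ x_{E'}` (`J_E ↪ J_{E'}`, `(x_{E'})_{w'} = x_w` in `E'_{w'} ⊇ E_w` for `w' ∣ w`) maps
`S`-idèles to `S`-idèles (`|x_w|_{w'} = |x_w|_w^{e(w'|w)} = 1` off `S`) and principal idèles to principal idèles, hence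
`𝒪_{E,S}ˣ = J_{E,S} ∩ Eˣ` into `𝒪_{E',S}ˣ`; these maps are morphisms of pairs `(Gal(E'/F), ·_{E'}) → (Gal(E/F), ·_E)`
(`τ • x_{E'} = ((τ|_E) • x)_{E'}`), i.e. morphisms `Res_{res}(·_E) ⟶ ·_{E'}` of `Gal(E'/F)`-modules compatible with the
inclusions `𝒪ˣ_{·,S} ↪ J_{·,S} ↪ J_·` and with `J_{·,S} → C_·`; they induce the inflation maps
`Inf : Hⁿ(Gal(E/F), J_{E,S}) → Hⁿ(Gal(E'/F), J_{E',S})` and `Inf : Hⁿ(Gal(E/F), 𝒪_{E,S}ˣ) → Hⁿ(Gal(E'/F), 𝒪_{E',S}ˣ)`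
(NSW (8.3.9)–(8.3.11): the direct systems whose limits are `Hⁿ(G_S, I_S)`, `Hⁿ(G_S, 𝒪_S^×)`), commuting with the tree's
`ideleInf` / `classInf` and with `Hⁿ` of the structure maps.

## What is formalised (`F E E' : Type` number fields, `[Algebra E E'] [IsScalarTower F E E'] [Normal F E]`,
## `S : Finset (HeightOneSpectrum (𝓞 F))`, `res = AlgEquiv.restrictNormalHom E`)

* §1 `valued_ideleBaseChange_apply` (`|x_{E'}|_{w'} = |x|_{w' ∩ E}^{e}`), `ideleBaseChange_mem_ideleS`
  (`J_{E,S} → J_{E',S}`).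
* §2 `ideleSInflHom F E E' S : Rep.res res (ideleSRep F E S) ⟶ ideleSRep F E' S` (the pair morphism `J_{E,S} → J_{E',S}`),
  `coe_toMul_ideleSInflHom_hom_apply`, **`ideleSInflHom_comp_ideleSRepHom`** (square with `J_{·,S} ↪ J_·` and the tree's
  `ideleInflHom`), **`res_ideleSToClass_comp_classInflHom`** (square with `J_{·,S} → C_·` and the tree's `classInflHom`).
* §3 `sUnitsIdeleInflHom F E E' S : Rep.res res (sUnitsIdeleRep F E S) ⟶ sUnitsIdeleRep F E' S` (the pair morphism
  `𝒪_{E,S}ˣ → 𝒪_{E',S}ˣ`, by the kernel universal property), **`sUnitsIdeleInflHom_comp_ι`** (square with `𝒪ˣ_{·,S} ↪ J_{·,S}`).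
* §4 `ideleSInf F E E' S n`, `sUnitsIdeleInf F E E' S n` (the inflations on `Hⁿ`), `ideleSInf_comp_map_ideleSRepHom`
  (`Inf ≫ Hⁿ(J_{E',S} ↪ J_{E'}) = Hⁿ(J_{E,S} ↪ J_E) ≫ ideleInf`), `sUnitsIdeleInf_comp_map_ι`
  (`Inf ≫ Hⁿ(𝒪ˣ ↪ J_S) = Hⁿ(𝒪ˣ ↪ J_S) ≫ Inf`), `ideleSInf_comp_map_ideleSToClass`
  (`Inf ≫ Hⁿ(J_{E',S} → C_{E'}) = Hⁿ(J_{E,S} → C_E) ≫ classInf`).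

Not here: the pair morphisms of the image `J_{·,S}·ˣ/·ˣ` and of the cokernel `Cl_S(·)` and the naturality of the
connecting homomorphisms (the "second road" of the lane memo; the cochain-level road of (A3d) does not use them).

## References
* J. Neukirch, A. Schmidt, K. Wingberg, *Cohomology of Number Fields*, 2nd ed. (2008), VIII §3, (8.3.9)–(8.3.11).
  [NeukirchSchmidtWingberg2008]
* J. W. S. Cassels, A. Fröhlich (eds.), *Algebraic Number Theory* (1967), Ch. II §19 (conorm of idèles), Ch. VII (J. Tate)
  §8, §11.1 (the exact commutative diagram of a tower). [CasselsFrohlichANT1967]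
* D. Harari, *Galois Cohomology and Class Field Theory*, Universitext, Springer (2020), §17.4 (17.1) (`E_S`, `I_S`, `C_S` as
  inductive limits over the layers). [Harari2020]
-/

noncomputable section

open NumberField IsDedekindDomain CategoryTheory CategoryTheory.Limits groupCohomology
open Literature.NumberTheory.Automorphic

namespace Literature.NumberTheory.GaloisRepresentations

namespace IdeleCohomology

open Literature.Algebra.Homology

variable {F E E' : Type} [Field F] [NumberField F] [Field E] [NumberField E] [Field E'] [NumberField E']
  [Algebra F E] [Algebra E E'] [Algebra F E'] [IsScalarTower F E E']
variable (S : Finset (HeightOneSpectrum (𝓞 F)))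

/-! ## §1. Base change maps `S`-idèles to `S`-idèles -/

omit [NumberField F] [Algebra F E] [Algebra F E'] [IsScalarTower F E E'] in
/-- **`|x_{E'}|_{w'} = |x|_{w}^{e(w'|w)}`** for the base change `x_{E'}` of an idèle `x` of `E` and a finite place `w'` of
`E'` above `w = w' ∩ E` (the tree's `valued_adicCompletionOfLiesOver` on the components of a base-changed idèle).
[cite: CasselsFrohlichANT1967, Ch. II §19 (conorm of idèles)] -/
theorem valued_ideleBaseChange_apply (x : ideleGroup E) (w' : HeightOneSpectrum (𝓞 E')) :
    Valued.v (((AdeleRing.ideleBaseChange E E' x : ideleGroup E') : AdeleRing (𝓞 E') E').2 w') =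
      Valued.v (((x : ideleGroup E) : AdeleRing (𝓞 E) E).2 (w'.under (𝓞 E))) ^
        (w'.under (𝓞 E)).asIdeal.ramificationIdx' w'.asIdeal := by
  haveI : w'.asIdeal.LiesOver (w'.under (𝓞 E)).asIdeal := ⟨rfl⟩
  rw [AdeleRing.coe_ideleBaseChange, AdeleRing.baseChange_snd, FiniteAdeleRing.baseChange_apply,
    adicCompletionOfUnder_eq E w' rfl, valued_adicCompletionOfLiesOver]

omit [NumberField F] in
/-- **Base change maps `J_{E,S}` into `J_{E',S}`** (`S` a set of places of the BASE `F`: a place `w'` of `E'` not above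
`S` lies over a place `w = w' ∩ E` of `E` not above `S`, where `|x_w|_w = 1`, so `|x_{E'}|_{w'} = 1^{e} = 1`).
[cite: CasselsFrohlichANT1967, Ch. II §19 (con `U_k ⊂ U_K`)][cite: NeukirchSchmidtWingberg2008, VIII §3 (8.3.9)] -/
theorem ideleBaseChange_mem_ideleS {x : ideleGroup E} (hx : x ∈ ideleS F E S) :
    AdeleRing.ideleBaseChange E E' x ∈ ideleS F E' S := by
  intro w' hw'
  rw [valued_ideleBaseChange_apply, hx (w'.under (𝓞 E)) (by rwa [HeightOneSpectrum.under_under F E E' w']), one_pow]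

/-! ## §2. The pair morphism `J_{E,S} → J_{E',S}` over `res : Gal(E'/F) → Gal(E/F)` -/

/-- `J_{E,S} →* J_{E',S}`, the restriction of the base change of idèles (multiplicative). [cite: NeukirchSchmidtWingberg2008, VIII §3 (8.3.9)] -/
def ideleSBaseChange : ideleS F E S →* ideleS F E' S :=
  ((AdeleRing.ideleBaseChange E E').comp (ideleS F E S).subtype).codRestrict (ideleS F E' S)
    fun x => ideleBaseChange_mem_ideleS (E' := E') S x.2

omit [NumberField F] in
/-- Unfolding of `ideleSBaseChange` on underlying idèles. [cite: NeukirchSchmidtWingberg2008, VIII §3 (8.3.9)] -/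
theorem coe_ideleSBaseChange (x : ideleS F E S) :
    ((ideleSBaseChange (E' := E') S x : ideleS F E' S) : ideleGroup E') = AdeleRing.ideleBaseChange E E' (x : ideleGroup E) :=
  rfl

variable [Normal F E]

variable (F E E') in
/-- **`J_{E,S} → J_{E',S}` as a morphism `Res_{res}(J_{E,S}) ⟶ J_{E',S}` of `Gal(E'/F)`-modules** (`x ↦ x_{E'}`; equivariance
`τ • x_{E'} = ((τ|_E) • x)_{E'}`, the tree's `AdeleRing.smul_ideleBaseChange_tower`).
[cite: NeukirchSchmidtWingberg2008, VIII §3 (8.3.9)][cite: CasselsFrohlichANT1967, Ch. VII §8] -/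
def ideleSInflHom : Rep.res (AlgEquiv.restrictNormalHom E) (ideleSRep F E S) ⟶ ideleSRep F E' S :=
  Rep.ofHom (LinearMap.intertwiningMap_of_isIntertwiningMap
    (Rep.res (AlgEquiv.restrictNormalHom E) (ideleSRep F E S)).ρ (ideleSRep F E' S).ρ
    (MonoidHom.toAdditive (ideleSBaseChange (E' := E') S)).toIntLinearMap fun τ x => by
      apply (Additive.toMul (α := ideleS F E' S)).injective
      refine Subtype.ext ?_
      change AdeleRing.ideleBaseChange E E'
          (((AlgEquiv.restrictNormalHom E τ) • ((Additive.toMul x : ideleS F E S) : ideleGroup E))) =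
        τ • AdeleRing.ideleBaseChange E E' ((Additive.toMul x : ideleS F E S) : ideleGroup E)
      rw [AdeleRing.smul_ideleBaseChange_tower]
      rfl)

/-- Unfolding `ideleSInflHom` on underlying idèles. [cite: NeukirchSchmidtWingberg2008, VIII §3 (8.3.9)] -/
theorem coe_toMul_ideleSInflHom_hom_apply (x : (Rep.res (AlgEquiv.restrictNormalHom E) (ideleSRep F E S)).V) :
    ((Additive.toMul ((ideleSInflHom F E E' S).hom x) : ideleS F E' S) : ideleGroup E') =
      AdeleRing.ideleBaseChange E E' ((Additive.toMul x : ideleS F E S) : ideleGroup E) := rfl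

/-- **The square `J_{E,S} ↪ J_E`, `J_{E',S} ↪ J_{E'}`**: the `S`-idèle pair morphism followed by the inclusion is the
inclusion followed by the tree's idèle pair morphism `ideleInflHom`. [cite: CasselsFrohlichANT1967, Ch. VII §11.1]
[cite: NeukirchSchmidtWingberg2008, VIII §3 (8.3.9)] -/
theorem ideleSInflHom_comp_ideleSRepHom :
    ideleSInflHom F E E' S ≫ ideleSRepHom S =
      (Rep.resFunctor (AlgEquiv.restrictNormalHom E)).map (ideleSRepHom S) ≫ ideleInflHom F E E' :=
  Rep.hom_ext (Representation.IntertwiningMap.ext (LinearMap.ext fun _ => rfl))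

/-- **The square `J_{E,S} → C_E`, `J_{E',S} → C_{E'}`**: `Res(J_{E,S} → C_E) ≫ (C_E → C_{E'}) = (J_{E,S} → J_{E',S}) ≫
(J_{E',S} → C_{E'})` (from the previous square and the tree's `res_classRepHom_comp_classInflHom`).
[cite: CasselsFrohlichANT1967, Ch. VII §11.1][cite: NeukirchSchmidtWingberg2008, VIII §3 (8.3.9)] -/
theorem res_ideleSToClass_comp_classInflHom :
    (Rep.resFunctor (AlgEquiv.restrictNormalHom E)).map (ideleSToClass S) ≫ classInflHom F E E' =
      ideleSInflHom F E E' S ≫ ideleSToClass S := by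
  rw [ideleSToClass, ideleSToClass, Functor.map_comp, Category.assoc, res_classRepHom_comp_classInflHom,
    ← Category.assoc, ← ideleSInflHom_comp_ideleSRepHom, Category.assoc]

/-! ## §3. The pair morphism `𝒪_{E,S}ˣ → 𝒪_{E',S}ˣ` -/

/-- `Res(𝒪_{E,S}ˣ ↪ J_{E,S}) ≫ (J_{E,S} → J_{E',S})` dies in `C_{E'}` (the class of a principal idèle stays trivial after
base change). [cite: NeukirchSchmidtWingberg2008, VIII §3 (8.3.9)] -/
theorem res_sUnitsIdeleι_comp_ideleSInflHom_comp_ideleSToClass :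
    ((Rep.resFunctor (AlgEquiv.restrictNormalHom E)).map (sUnitsIdeleι S) ≫ ideleSInflHom F E E' S) ≫
      ideleSToClass S = 0 := by
  rw [Category.assoc, ← res_ideleSToClass_comp_classInflHom, ← Category.assoc, ← Functor.map_comp,
    sUnitsIdeleι_comp_ideleSToClass, Functor.map_zero, zero_comp]

variable (F E E') in
/-- **`𝒪_{E,S}ˣ → 𝒪_{E',S}ˣ` as a morphism `Res_{res}(𝒪_{E,S}ˣ) ⟶ 𝒪_{E',S}ˣ` of `Gal(E'/F)`-modules** (the base change
of a principal `S`-idèle is a principal `S`-idèle: the lift of `Res(𝒪_{E,S}ˣ ↪ J_{E,S}) ≫ (J_{E,S} → J_{E',S})` through the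
kernel `𝒪_{E',S}ˣ ↪ J_{E',S}`). [cite: NeukirchSchmidtWingberg2008, VIII §3 (8.3.9)][cite: Harari2020, §17.4 (17.1)] -/
def sUnitsIdeleInflHom : Rep.res (AlgEquiv.restrictNormalHom E) (sUnitsIdeleRep F E S) ⟶ sUnitsIdeleRep F E' S :=
  sUnitsIdeleLift ((Rep.resFunctor (AlgEquiv.restrictNormalHom E)).map (sUnitsIdeleι S) ≫ ideleSInflHom F E E' S)
    (res_sUnitsIdeleι_comp_ideleSInflHom_comp_ideleSToClass S)

/-- **The square `𝒪_{E,S}ˣ ↪ J_{E,S}`, `𝒪_{E',S}ˣ ↪ J_{E',S}`.** [cite: NeukirchSchmidtWingberg2008, VIII §3 (8.3.9)]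
[cite: CasselsFrohlichANT1967, Ch. VII §11.1] -/
theorem sUnitsIdeleInflHom_comp_ι :
    sUnitsIdeleInflHom F E E' S ≫ sUnitsIdeleι S =
      (Rep.resFunctor (AlgEquiv.restrictNormalHom E)).map (sUnitsIdeleι S) ≫ ideleSInflHom F E E' S :=
  sUnitsIdeleLift_comp_ι _ _

/-- Unfolding `sUnitsIdeleInflHom` on underlying idèles: it is the base change. [cite: NeukirchSchmidtWingberg2008, VIII §3 (8.3.9)] -/
theorem coe_toMul_sUnitsIdeleInflHom_hom_apply (x : (Rep.res (AlgEquiv.restrictNormalHom E) (sUnitsIdeleRep F E S)).V) :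
    ((Additive.toMul ((sUnitsIdeleι S).hom ((sUnitsIdeleInflHom F E E' S).hom x)) : ideleS F E' S) : ideleGroup E') =
      AdeleRing.ideleBaseChange E E'
        ((Additive.toMul ((sUnitsIdeleι S).hom (show (sUnitsIdeleRep F E S).V from x)) : ideleS F E S) : ideleGroup E) := by
  have h := congrArg (fun φ => φ.hom x) (sUnitsIdeleInflHom_comp_ι (F := F) (E := E) (E' := E') S)
  exact congrArg (fun y : (ideleSRep F E' S).V => ((Additive.toMul y : ideleS F E' S) : ideleGroup E')) h

/-! ## §4. The inflations on `Hⁿ` and their squares -/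

variable (F E E') in
/-- **`Inf : Hⁿ(Gal(E/F), J_{E,S}) → Hⁿ(Gal(E'/F), J_{E',S})`** (Mathlib `groupCohomology.map res (J_{E,S} → J_{E',S})`; the
transition maps of NSW's direct system `Hⁿ(G_S, I_S) = lim→ Hⁿ(Gal(E/F), J_{E,S})`).
[cite: NeukirchSchmidtWingberg2008, VIII §3 (8.3.10)][cite: CasselsFrohlichANT1967, Ch. VII §11.1] -/
def ideleSInf (n : ℕ) : groupCohomology (ideleSRep F E S) n ⟶ groupCohomology (ideleSRep F E' S) n :=
  groupCohomology.map (AlgEquiv.restrictNormalHom E) (ideleSInflHom F E E' S) n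

variable (F E E') in
/-- **`Inf : Hⁿ(Gal(E/F), 𝒪_{E,S}ˣ) → Hⁿ(Gal(E'/F), 𝒪_{E',S}ˣ)`** (Mathlib `groupCohomology.map res (𝒪_{E,S}ˣ → 𝒪_{E',S}ˣ)`;
the transition maps of NSW's direct system `Hⁿ(G_S, 𝒪_S^×) = lim→ Hⁿ(Gal(E/F), 𝒪_{E,S}ˣ)`).
[cite: NeukirchSchmidtWingberg2008, VIII §3 (8.3.11)][cite: Harari2020, §17.4 (17.1)] -/
def sUnitsIdeleInf (n : ℕ) : groupCohomology (sUnitsIdeleRep F E S) n ⟶ groupCohomology (sUnitsIdeleRep F E' S) n :=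
  groupCohomology.map (AlgEquiv.restrictNormalHom E) (sUnitsIdeleInflHom F E E' S) n

/-- **`Inf ∘ Hⁿ(J_{E,S} ↪ J_E) = Hⁿ(J_{E',S} ↪ J_{E'}) ∘ Inf`**: the `S`-idèle inflation is compatible with the tree's
`ideleInf` through `Hⁿ` of the inclusions. [cite: CasselsFrohlichANT1967, Ch. VII §11.1][cite: NeukirchSchmidtWingberg2008, VIII §3 (8.3.10)] -/
theorem ideleSInf_comp_map_ideleSRepHom (n : ℕ) :
    ideleSInf F E E' S n ≫ groupCohomology.map (MonoidHom.id _) (ideleSRepHom S) n =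
      groupCohomology.map (MonoidHom.id _) (ideleSRepHom S) n ≫ ideleInf F E E' n := by
  rw [ideleSInf, ideleInf, ← groupCohomology.map_comp, ← groupCohomology.map_comp]
  exact map_congr' (by rw [MonoidHom.id_comp, MonoidHom.comp_id]) _ _
    (fun x => congrArg (fun φ => φ.hom x) (ideleSInflHom_comp_ideleSRepHom (F := F) (E := E) (E' := E') S)) n

/-- Element form of `ideleSInf_comp_map_ideleSRepHom`. [cite: CasselsFrohlichANT1967, Ch. VII §11.1] -/
theorem map_ideleSRepHom_ideleSInf (n : ℕ) (c : groupCohomology (ideleSRep F E S) n) :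
    groupCohomology.map (MonoidHom.id _) (ideleSRepHom S) n (ideleSInf F E E' S n c) =
      ideleInf F E E' n (groupCohomology.map (MonoidHom.id _) (ideleSRepHom S) n c) := by
  change (ideleSInf F E E' S n ≫ groupCohomology.map (MonoidHom.id _) (ideleSRepHom S) n) c = _
  rw [ideleSInf_comp_map_ideleSRepHom]
  rfl

/-- **`Inf ∘ Hⁿ(𝒪_{E,S}ˣ ↪ J_{E,S}) = Hⁿ(𝒪_{E',S}ˣ ↪ J_{E',S}) ∘ Inf`.** [cite: NeukirchSchmidtWingberg2008, VIII §3 (8.3.11)]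
[cite: CasselsFrohlichANT1967, Ch. VII §11.1] -/
theorem sUnitsIdeleInf_comp_map_ι (n : ℕ) :
    sUnitsIdeleInf F E E' S n ≫ groupCohomology.map (MonoidHom.id _) (sUnitsIdeleι S) n =
      groupCohomology.map (MonoidHom.id _) (sUnitsIdeleι S) n ≫ ideleSInf F E E' S n := by
  rw [sUnitsIdeleInf, ideleSInf, ← groupCohomology.map_comp, ← groupCohomology.map_comp]
  exact map_congr' (by rw [MonoidHom.id_comp, MonoidHom.comp_id]) _ _
    (fun x => congrArg (fun φ => φ.hom x) (sUnitsIdeleInflHom_comp_ι (F := F) (E := E) (E' := E') S)) n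

/-- Element form of `sUnitsIdeleInf_comp_map_ι`. [cite: NeukirchSchmidtWingberg2008, VIII §3 (8.3.11)] -/
theorem map_sUnitsIdeleι_sUnitsIdeleInf (n : ℕ) (x : groupCohomology (sUnitsIdeleRep F E S) n) :
    groupCohomology.map (MonoidHom.id _) (sUnitsIdeleι S) n (sUnitsIdeleInf F E E' S n x) =
      ideleSInf F E E' S n (groupCohomology.map (MonoidHom.id _) (sUnitsIdeleι S) n x) := by
  change (sUnitsIdeleInf F E E' S n ≫ groupCohomology.map (MonoidHom.id _) (sUnitsIdeleι S) n) x = _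
  rw [sUnitsIdeleInf_comp_map_ι]
  rfl

/-- **`Inf ∘ Hⁿ(J_{E,S} → C_E) = Hⁿ(J_{E',S} → C_{E'}) ∘ Inf`**: the `S`-idèle inflation is compatible with the tree's
`classInf` through `Hⁿ(J_{·,S} → C_·)`. [cite: CasselsFrohlichANT1967, Ch. VII §11.1][cite: NeukirchSchmidtWingberg2008, VIII §3 (8.3.11)] -/
theorem ideleSInf_comp_map_ideleSToClass (n : ℕ) :
    ideleSInf F E E' S n ≫ groupCohomology.map (MonoidHom.id _) (ideleSToClass S) n =
      groupCohomology.map (MonoidHom.id _) (ideleSToClass S) n ≫ classInf F E E' n := by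
  rw [ideleSInf, classInf, ← groupCohomology.map_comp, ← groupCohomology.map_comp]
  exact map_congr' (by rw [MonoidHom.id_comp, MonoidHom.comp_id]) _ _
    (fun x => (congrArg (fun φ => φ.hom x) (res_ideleSToClass_comp_classInflHom (F := F) (E := E) (E' := E') S)).symm) n

/-- Element form of `ideleSInf_comp_map_ideleSToClass`. [cite: CasselsFrohlichANT1967, Ch. VII §11.1] -/
theorem map_ideleSToClass_ideleSInf (n : ℕ) (c : groupCohomology (ideleSRep F E S) n) :
    groupCohomology.map (MonoidHom.id _) (ideleSToClass S) n (ideleSInf F E E' S n c) =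
      classInf F E E' n (groupCohomology.map (MonoidHom.id _) (ideleSToClass S) n c) := by
  change (ideleSInf F E E' S n ≫ groupCohomology.map (MonoidHom.id _) (ideleSToClass S) n) c = _
  rw [ideleSInf_comp_map_ideleSToClass]
  rfl

end IdeleCohomology

end Literature.NumberTheory.GaloisRepresentations

end
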